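import Summits.CriticalPhenomena.PercolationContinuityZ3.Theorems.PercLowPointHalfSpaceQuantitativeBGNThinFootReshape
import Summits.CriticalPhenomena.PercolationContinuityZ3.Theses.PercPorousCritical
import HarnessLib

/-!
# `PercPorousCritical.QuantitativeBGN` (stmt-CriticalPhenomena-0913) — route-level SPLIT into its fat and thin parts

The crux `QuantitativeBGN` (`∃ a C, 0 < a ∧ ∀ r ≥ 1, P_{p_c(ℤ³)}(arm_H(0,r)) ≤ C r^{-a}`, a RATE in
Barsky–Grimmett–Newman's `θ_H(p_c) = 0`) is shared by five routes; on route `PercPorousCritical` its decl is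
`Summit.CriticalPhenomena.PercolationContinuityZ3.Theses.PercPorousCritical.QuantitativeBGN` (same term as the
`PercLowPointHalfSpace` decl). Leads c4/c5 of the line `longrange-wall-ghost-bootstrap` landed the EXACT cut
`QuantitativeBGN ⟺ FootprintTail ∧ ThinFootTall` (`quantitativeBGN_of_footprintTail_of_thinFootTall`,
`footprintTail_of_quantitativeBGN`, `thinFootTall_of_quantitativeBGN`, files `…WallChain.lean`,
`…ThinFootReshape.lean`):

* FAT part `FootprintTail`: `∃ θ > 0, B, ∀ n ≥ 1, P_{p_c}(|C_H(0) ∩ ∂H| ≥ n) ≤ B n^{-θ}` — a volume-type tail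
  for the wall footprint `F = |C_H(0) ∩ {x₀ = 0}|` of the critical half-space cluster;
* THIN part `ThinFootTall`: `∃ a, δ > 0, C, ∀ r ≥ 1, P_{p_c}(arm_H(0,r) ∧ F ≤ ⌊r^δ⌋) ≤ C r^{-a}` — an arm-type
  rate on the atypical corner "far-reaching with few wall contacts".

This file re-types the cut for the `PercPorousCritical` copy of the crux with both parts spelled out over the
crux's OWN vocabulary (`bondPercolation`, `criticalProbI`, `openConnIn {x | 0 ≤ x 0}`, `Site 3`, `Set.encard`),
which is all the route file `Theses/PercPorousCritical.lean` can see (it imports no half-space Literature file).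
The identifications with the WallDefs vocabulary (`armH r`, `footAt ω 0`, `footGe 0 n`, `clusterH ω 0`) and with the
`PercLowPointHalfSpace` decl are DEFINITIONAL, so every proof below is a landed theorem, re-typed (crux-strategist
s2 pass, 2026-08-17). No definitions, no new mathematics.
-/

namespace Summit.CriticalPhenomena.PercolationContinuityZ3.Theorems

open MeasureTheory Literature.Probability.Percolation Literature.Probability.LatticeModels
open scoped ENNReal

/-- The two route decls of the shared crux are the same proposition. [folklore] -/
theorem quantitativeBGN_porous_iff_lowPoint :
    Summit.CriticalPhenomena.PercolationContinuityZ3.Theses.PercPorousCritical.QuantitativeBGN ↔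
      Summit.CriticalPhenomena.PercolationContinuityZ3.Theses.PercLowPointHalfSpace.QuantitativeBGN :=
  Iff.rfl

/-- **Glue of the split on route `PercPorousCritical`**: `FootprintTail → ThinFootTall → QuantitativeBGN`, both
hypotheses spelled out over the crux vocabulary exactly as the route children state them
(`quantitativeBGN_of_footprintTail_of_thinFootTall` re-typed; `footGe 0 n`, `armH r`, `footAt ω 0` unfold by `rfl`).
[folklore] -/
theorem quantitativeBGN_porous_of_subs :
    (∃ θ B : ℝ, 0 < θ ∧ ∀ n : ℕ, 1 ≤ n → (Literature.Probability.Percolation.bondPercolation (Literature.Probability.LatticeModels.zdGraph 3) (Literature.Probability.Percolation.criticalProbI 3)).real {ω | (n : ℕ∞) ≤ ({v : Literature.Probability.LatticeModels.Site 3 | ω ∈ Literature.Probability.Percolation.openConnIn {x : Literature.Probability.LatticeModels.Site 3 | 0 ≤ x 0} 0 v} ∩ {v : Literature.Probability.LatticeModels.Site 3 | v 0 = 0}).encard} ≤ B * (n : ℝ) ^ (-θ)) →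
    (∃ a δ C : ℝ, 0 < a ∧ 0 < δ ∧ ∀ r : ℕ, 1 ≤ r → (Literature.Probability.Percolation.bondPercolation (Literature.Probability.LatticeModels.zdGraph 3) (Literature.Probability.Percolation.criticalProbI 3)).real ({ω | ∃ y : Literature.Probability.LatticeModels.Site 3, (∃ i : Fin 3, (r : ℤ) ≤ |y i|) ∧ ω ∈ Literature.Probability.Percolation.openConnIn {x : Literature.Probability.LatticeModels.Site 3 | 0 ≤ x 0} 0 y} ∩ {ω | ({v : Literature.Probability.LatticeModels.Site 3 | ω ∈ Literature.Probability.Percolation.openConnIn {x : Literature.Probability.LatticeModels.Site 3 | 0 ≤ x 0} 0 v} ∩ {v : Literature.Probability.LatticeModels.Site 3 | v 0 = 0}).encard ≤ ((⌊(r : ℝ) ^ δ⌋₊ : ℕ) : ℕ∞)}) ≤ C * (r : ℝ) ^ (-a)) →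
    Summit.CriticalPhenomena.PercolationContinuityZ3.Theses.PercPorousCritical.QuantitativeBGN :=
  fun hF hT => quantitativeBGN_of_footprintTail_of_thinFootTall hF hT

/-- Necessity of the fat child on route `PercPorousCritical` (`footprintTail_of_quantitativeBGN` re-typed: a footprint
of `n` wall vertices forces an arm to sup-distance `⌊√n⌋/2`, so θ = a/2). [folklore] -/
theorem footprintTail_porous_of_quantitativeBGN
    (h : Summit.CriticalPhenomena.PercolationContinuityZ3.Theses.PercPorousCritical.QuantitativeBGN) :
    ∃ θ B : ℝ, 0 < θ ∧ ∀ n : ℕ, 1 ≤ n → (Literature.Probability.Percolation.bondPercolation (Literature.Probability.LatticeModels.zdGraph 3) (Literature.Probability.Percolation.criticalProbI 3)).real {ω | (n : ℕ∞) ≤ ({v : Literature.Probability.LatticeModels.Site 3 | ω ∈ Literature.Probability.Percolation.openConnIn {x : Literature.Probability.LatticeModels.Site 3 | 0 ≤ x 0} 0 v} ∩ {v : Literature.Probability.LatticeModels.Site 3 | v 0 = 0}).encard} ≤ B * (n : ℝ) ^ (-θ) :=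
  footprintTail_of_quantitativeBGN h

/-- Necessity of the thin child on route `PercPorousCritical` (`thinFootTall_of_quantitativeBGN` re-typed: the thin-foot
arm event is inside `arm_H(0,r)`). [folklore] -/
theorem thinFootTall_porous_of_quantitativeBGN
    (h : Summit.CriticalPhenomena.PercolationContinuityZ3.Theses.PercPorousCritical.QuantitativeBGN) :
    ∃ a δ C : ℝ, 0 < a ∧ 0 < δ ∧ ∀ r : ℕ, 1 ≤ r → (Literature.Probability.Percolation.bondPercolation (Literature.Probability.LatticeModels.zdGraph 3) (Literature.Probability.Percolation.criticalProbI 3)).real ({ω | ∃ y : Literature.Probability.LatticeModels.Site 3, (∃ i : Fin 3, (r : ℤ) ≤ |y i|) ∧ ω ∈ Literature.Probability.Percolation.openConnIn {x : Literature.Probability.LatticeModels.Site 3 | 0 ≤ x 0} 0 y} ∩ {ω | ({v : Literature.Probability.LatticeModels.Site 3 | ω ∈ Literature.Probability.Percolation.openConnIn {x : Literature.Probability.LatticeModels.Site 3 | 0 ≤ x 0} 0 v} ∩ {v : Literature.Probability.LatticeModels.Site 3 | v 0 = 0}).encard ≤ ((⌊(r : ℝ) ^ δ⌋₊ : ℕ)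 : ℕ∞)}) ≤ C * (r : ℝ) ^ (-a) :=
  thinFootTall_of_quantitativeBGN h

/-- **Exactness of the cut on route `PercPorousCritical`**: `QuantitativeBGN ⟺ FootprintTail ∧ ThinFootTall`. [folklore] -/
theorem quantitativeBGN_porous_iff_subs :
    Summit.CriticalPhenomena.PercolationContinuityZ3.Theses.PercPorousCritical.QuantitativeBGN ↔
      ((∃ θ B : ℝ, 0 < θ ∧ ∀ n : ℕ, 1 ≤ n → (Literature.Probability.Percolation.bondPercolation (Literature.Probability.LatticeModels.zdGraph 3) (Literature.Probability.Percolation.criticalProbI 3)).real {ω | (n : ℕ∞) ≤ ({v : Literature.Probability.LatticeModels.Site 3 | ω ∈ Literature.Probability.Percolation.openConnIn {x : Literature.Probability.LatticeModels.Site 3 | 0 ≤ x 0} 0 v} ∩ {v : Literature.Probability.LatticeModels.Site 3 | v 0 = 0}).encard} ≤ B * (n : ℝ) ^ (-θ)) ∧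
       (∃ a δ C : ℝ, 0 < a ∧ 0 < δ ∧ ∀ r : ℕ, 1 ≤ r → (Literature.Probability.Percolation.bondPercolation (Literature.Probability.LatticeModels.zdGraph 3) (Literature.Probability.Percolation.criticalProbI 3)).real ({ω | ∃ y : Literature.Probability.LatticeModels.Site 3, (∃ i : Fin 3, (r : ℤ) ≤ |y i|) ∧ ω ∈ Literature.Probability.Percolation.openConnIn {x : Literature.Probability.LatticeModels.Site 3 | 0 ≤ x 0} 0 y} ∩ {ω | ({v : Literature.Probability.LatticeModels.Site 3 | ω ∈ Literature.Probability.Percolation.openConnIn {x : Literature.Probability.LatticeModels.Site 3 | 0 ≤ x 0} 0 v} ∩ {v : Literature.Probability.LatticeModels.Site 3 | v 0 = 0}).encard ≤ ((⌊(r : ℝ) ^ δ⌋₊ : ℕ) : ℕ∞)}) ≤ C * (r : ℝ) ^ (-a))) :=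
  ⟨fun h => ⟨footprintTail_porous_of_quantitativeBGN h, thinFootTall_porous_of_quantitativeBGN h⟩,
    fun h => quantitativeBGN_porous_of_subs h.1 h.2⟩

end Summit.CriticalPhenomena.PercolationContinuityZ3.Theorems
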